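import Summits.ResolutionOfSingularities.ResolutionOfSingularities.Theorems.HomologicalConductorNoZenoExcCurvesBaseChange
import Mathlib.AlgebraicGeometry.Morphisms.UniversallyOpen
import HarnessLib

/-!
# Crux `NoZenoR` (stmt-ResolutionOfSingularities-19943), slot 5 `stub_L1wCoreF3` — GAP-N2 (i) = (NODE2-up):
# two distinct exceptional curves through a node downstairs give two distinct exceptional curves through every point
# over it upstairs

OURS (cell res-hironaka, chain W4.4; stub worker res-L0-w44-stub-4 g8; object (P2) of res-L0-w44-plan-1 DESK WORD 19
after the lead seat res-L0-w44-lead-1's GAP-N2 census (i)).  Nothing here is a statement of the manuscript under review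
(Hironaka 2017); AI-written, weaker than expert review; def-free, fact-free.  Companion of res-L0-w44-stub-2's
`…NoZenoExcCurvesBaseChange` (BC-2a), whose commuting-square currency is used verbatim: `π : X → Spec R`,
`π_B : X_B → Spec R_B`, `σ : X_B → X`, `g : Spec R_B → Spec R`, `σ ≫ π = π_B ≫ g`, `g ⁻¹' {𝔪_R} = {𝔪_{R_B}}`, with `σ`
universally closed and locally quasi-finite (e.g. finite) — and here moreover FLAT.

* `exists_excCurvePoint_specializes_of_sq` — SPECIALISATION LIFTING: for `η ∈ excCurvePoints π` with `η ⤳ σ z₁` there is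
  `a ∈ excCurvePoints π_B` with `a ⤳ z₁` and `σ a = η` (flat ⇒ generalising, Mathlib `Flat.generalizingMap`; membership by
  `mem_excCurvePoints_iff_of_sq`);
* **`exists_two_excCurvePoints_specializes_of_sq`** — (NODE2-up) (i): `η_a ≠ η_b ∈ excCurvePoints π`,
  `z ∈ closure {η_a} ∩ closure {η_b}`, `σ z₁ = z` ⇒ `∃ a ≠ b ∈ excCurvePoints π_B` with `a ⤳ z₁`, `b ⤳ z₁`, `σ a = η_a`,
  `σ b = η_b`;
* `exists_two_excCurvePoints_specializes_pullback` — the instance `X_B = X ×_{Spec R} Spec R_B`, `σ = pullback.fst`,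
  `π_B = pullback.snd`, for `g` finite and flat (the base-change square of `SplittingBase.exists_upstairs_binders`).

References: U. Görtz, T. Wedhorn, *Algebraic Geometry I* (2020), Lemma 14.9 / Cor. 14.11 (flat ⇒ generalisations lift)
[`GortzWedhorn2020`]; J. Lipman, Publ. Math. IHÉS 36 (1969), §12 p. 220 (exceptional curves) [`Lipman1969`].
-/

noncomputable section

-- single-problem summit: the doubled namespace component `ResolutionOfSingularities` is forced
set_option linter.dupNamespace false

namespace Summit.ResolutionOfSingularities.ResolutionOfSingularities.Theorems.NoZeno.ExcCount

open CategoryTheory CategoryTheory.Limits AlgebraicGeometry IsLocalRing Topology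
open Literature.AlgebraicGeometry.Resolution

universe u

/-! ## Specialisation lifting of exceptional curves along a flat, finite-like `σ` -/

section Square

variable {R RB : Type u} [CommRing R] [IsLocalRing R] [CommRing RB] [IsLocalRing RB]
  {X XB : Scheme.{u}} (π : X ⟶ Spec (.of R)) (πB : XB ⟶ Spec (.of RB)) (σ : XB ⟶ X)
  (g : Spec (.of RB) ⟶ Spec (.of R)) (hsq : σ ≫ π = πB ≫ g)
  (hg : g.base ⁻¹' {closedPoint R} = {closedPoint RB})

include hsq hg in
/-- **Specialisation lifting of an exceptional curve along `σ`**: if `η` is (the generic point of) an integral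
exceptional curve of `π` specialising to `σ z₁`, some integral exceptional curve `a` of `π_B` specialises to `z₁` and
lies over `η` — `σ` flat lifts generalisations, and `a` is exceptional by `mem_excCurvePoints_iff_of_sq`.
[cite: GortzWedhorn2020, Lemma 14.9] -/
theorem exists_excCurvePoint_specializes_of_sq [UniversallyClosed σ] [LocallyQuasiFinite σ] [Flat σ]
    {η : X} (hη : η ∈ excCurvePoints π) {z₁ : XB} (hz : η ⤳ σ.base z₁) :
    ∃ a : XB, a ∈ excCurvePoints πB ∧ a ⤳ z₁ ∧ σ.base a = η := by
  obtain ⟨a, haz, hσa⟩ := Flat.generalizingMap σ hz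
  refine ⟨a, ?_, haz, hσa⟩
  rw [mem_excCurvePoints_iff_of_sq π πB σ g hsq hg a, hσa]
  exact hη

include hsq hg in
/-- **(NODE2-up) (i) — two distinct exceptional curves through a node downstairs lift to two distinct exceptional
curves through every point over the node.**  For `η_a ≠ η_b` integral exceptional curves of `π` both passing through
`z` (`z ∈ closure {η_a} ∩ closure {η_b}`) and any `z₁` with `σ z₁ = z`, there are integral exceptional curves `a ≠ b`
of `π_B` through `z₁` lying over `η_a` and `η_b` respectively. [this work] -/
theorem exists_two_excCurvePoints_specializes_of_sq [UniversallyClosed σ] [LocallyQuasiFinite σ] [Flat σ]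
    {ηa ηb : X} (ha : ηa ∈ excCurvePoints π) (hb : ηb ∈ excCurvePoints π) (hne : ηa ≠ ηb)
    {z : X} (hz : z ∈ closure ({ηa} : Set X) ∩ closure ({ηb} : Set X)) :
    ∀ z₁ : XB, σ.base z₁ = z →
      ∃ a b : XB, a ∈ excCurvePoints πB ∧ b ∈ excCurvePoints πB ∧ a ≠ b ∧ a ⤳ z₁ ∧ b ⤳ z₁ ∧
        σ.base a = ηa ∧ σ.base b = ηb := by
  intro z₁ hz₁
  have hza : ηa ⤳ σ.base z₁ := by rw [hz₁]; exact specializes_iff_mem_closure.mpr hz.1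
  have hzb : ηb ⤳ σ.base z₁ := by rw [hz₁]; exact specializes_iff_mem_closure.mpr hz.2
  obtain ⟨a, haE, haz, hσa⟩ := exists_excCurvePoint_specializes_of_sq π πB σ g hsq hg ha hza
  obtain ⟨b, hbE, hbz, hσb⟩ := exists_excCurvePoint_specializes_of_sq π πB σ g hsq hg hb hzb
  refine ⟨a, b, haE, hbE, ?_, haz, hbz, hσa, hσb⟩
  rintro rfl
  exact hne (hσa.symm.trans hσb)

include hsq hg in
/-- The same with the node given by specialisations `η_a ⤳ z`, `η_b ⤳ z`. [this work] -/
theorem exists_two_excCurvePoints_specializes_of_sq' [UniversallyClosed σ] [LocallyQuasiFinite σ] [Flat σ]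
    {ηa ηb : X} (ha : ηa ∈ excCurvePoints π) (hb : ηb ∈ excCurvePoints π) (hne : ηa ≠ ηb)
    {z : X} (hza : ηa ⤳ z) (hzb : ηb ⤳ z) {z₁ : XB} (hz₁ : σ.base z₁ = z) :
    ∃ a b : XB, a ∈ excCurvePoints πB ∧ b ∈ excCurvePoints πB ∧ a ≠ b ∧ a ⤳ z₁ ∧ b ⤳ z₁ ∧
      σ.base a = ηa ∧ σ.base b = ηb :=
  exists_two_excCurvePoints_specializes_of_sq π πB σ g hsq hg ha hb hne
    ⟨specializes_iff_mem_closure.mp hza, specializes_iff_mem_closure.mp hzb⟩ z₁ hz₁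

end Square

/-! ## The pullback `X_B = X ×_{Spec R} Spec R_B` along a finite flat `g` -/

section Pullback

variable {R RB : Type u} [CommRing R] [IsLocalRing R] [CommRing RB] [IsLocalRing RB]
  {X : Scheme.{u}} (π : X ⟶ Spec (.of R)) (g : Spec (.of RB) ⟶ Spec (.of R))
  (hg : g.base ⁻¹' {closedPoint R} = {closedPoint RB})

include hg in
/-- **(NODE2-up) (i) for the base-change square** `X_B := X ×_{Spec R} Spec R_B` along a finite flat `g` with
`g ⁻¹' {𝔪_R} = {𝔪_{R_B}}`: two distinct exceptional curves of `π` through `z` give, through every point `z₁` of `X_B`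
over `z`, two distinct exceptional curves of `π_B = pullback.snd π g` lying over them. [this work] -/
theorem exists_two_excCurvePoints_specializes_pullback [IsFinite g] [Flat g]
    {ηa ηb : X} (ha : ηa ∈ excCurvePoints π) (hb : ηb ∈ excCurvePoints π) (hne : ηa ≠ ηb)
    {z : X} (hz : z ∈ closure ({ηa} : Set X) ∩ closure ({ηb} : Set X)) :
    ∀ z₁ : ↑(pullback π g), (pullback.fst π g).base z₁ = z →
      ∃ a b : ↑(pullback π g), a ∈ excCurvePoints (pullback.snd π g) ∧ b ∈ excCurvePoints (pullback.snd π g) ∧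
        a ≠ b ∧ a ⤳ z₁ ∧ b ⤳ z₁ ∧ (pullback.fst π g).base a = ηa ∧ (pullback.fst π g).base b = ηb :=
  exists_two_excCurvePoints_specializes_of_sq π (pullback.snd π g) (pullback.fst π g) g pullback.condition hg
    ha hb hne hz

end Pullback

end Summit.ResolutionOfSingularities.ResolutionOfSingularities.Theorems.NoZeno.ExcCount

end
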